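import Summits.CriticalPhenomena.CardyFormulaZ2.Theorems.CardyComplexConeParafermionToSLESixFamiliesDiamondCollarDepth
import HarnessLib

/-!
# The collar of line `potential-darboux-picard-diamond`, part 2: the cell chain through the bulk of the diamond

Crux `ParafermionToSLESixFamilies` (stmt-CriticalPhenomena-11389), line `potential-darboux-picard-diamond`, conditional
helper `collar_of_uniformInnerEnvelope : UniformInnerEnvelope → ClosedCollar` of S3 (a). Setting: a datum `E` on a
convex domain read at mesh `δ`, every lattice point of the domain in `Ω_δ`, lattice points = the box `a ≤ x₀ + x₁ ≤ b`,
`a' ≤ x₁ − x₀ ≤ b'` (the landed `diamondCollar_box`), a lattice depth function `m` (characterised by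
`μ ≤ m x ↔ μ ≤` the four side distances), and corner observables at sites of depth `m ≥ 2` bounded by `C₁ m^{−1/3}` (the
landed depth form `obsBound_of_uniformInnerEnvelope` of `UniformInnerEnvelope`). Then:

* `Collar.isInnerFace_of_margin`, `Collar.not_mem_zdBoundary_of_margin` — every face at a site of depth `≥ 2` is inner and
  the site is off the discrete boundary, so an exact pair's increment there is one weighted corner observable
  (`Collar.norm_sub_face_le`) and two lattice neighbours of depth `≥ 2` carry site potentials `Φ` at distance `≤` the two
  corner bounds (`Collar.norm_step_le`, through the common face `faceAt u k`);
* `Collar.norm_inward_le`, `Collar.norm_across_le` — the two kinds of straight legs, summed with `diamondCollar_legSum`;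
* `Collar.margin_inward`, `Collar.margin_near` — the depths along the legs (pure `omega` bookkeeping in the box);
* `diamondCollar_walk` (registered) — for interior sites `v`, `v'` within `N` of each other in each coordinate, in a box of
  side lengths `≥ 16N + 4`: `‖Φ v − Φ v'‖ ≤ 10 C₁ (3N + 1)^{2/3}`, by the chain INWARD from `v` (`3N` diagonal steps, the
  `j`-th at depth `≥ j + 2`), ACROSS (`≤ N + N` axis steps at depth `≥ N + 2`) and back OUT to `v'`.

Pure lattice bookkeeping plus the triangle inequality; nothing cited.
-/

noncomputable section

namespace Summit.CriticalPhenomena.CardyFormulaZ2.Cruxes.ParafermionToSLESixFamilies.PotentialDarbouxPicardDiamond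

open scoped BigOperators
open Set Metric Complex
open Literature.Probability Literature.Probability.LatticeModels Literature.Probability.Percolation
open Literature.Probability.LatticeModels.DiscreteDobrushin
open Literature.Probability.RandomPlanarGeometry
open Summit.CriticalPhenomena.CardyFormulaZ2.Cruxes.EdgePrecompact.QkzStripBoundaryArm (cornerObs not_mem_zdBoundary_of_forall_isInnerFace)

namespace Collar

/-! ## Coordinates along straight lattice walks -/

/-- The sites `u + j • cornerUnit k` of the four straight lattice walks, in coordinates. -/
theorem walk_apply (u : Site 2) (j : ℤ) :
    (((u + j • cornerUnit 0) 0 = u 0 + j ∧ (u + j • cornerUnit 0) 1 = u 1) ∧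
      ((u + j • cornerUnit 1) 0 = u 0 ∧ (u + j • cornerUnit 1) 1 = u 1 + j)) ∧
      ((u + j • cornerUnit 2) 0 = u 0 - j ∧ (u + j • cornerUnit 2) 1 = u 1) ∧
      ((u + j • cornerUnit 3) 0 = u 0 ∧ (u + j • cornerUnit 3) 1 = u 1 - j) := by
  simp [cornerUnit, sub_eq_add_neg]

/-- One more step of a straight walk: `u + (j+1) • w = (u + j • w) + w`. -/
theorem walk_succ (u w : Site 2) (j : ℕ) : u + ((j + 1 : ℕ) : ℤ) • w = u + (j : ℤ) • w + w := by
  push_cast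
  rw [add_smul, one_smul, add_assoc]

/-! ## One step of the chain: two interior sites sharing a face -/

section Step

variable {E : DiscreteDobrushin} {δ : ℝ} {a b a' b' : ℤ} {m : Site 2 → ℤ} {C₁ : ℝ} {Φ Ψ : Site 2 → ℂ}
  (hconv : Convex ℝ E.Ω) (hEδ : E.δ = δ)
  (hgood : ∀ x : Site 2, meshPoint δ x ∈ E.Ω → x ∈ meshDomain E.Ω δ)
  (hbox : ∀ x : Site 2, meshPoint δ x ∈ E.Ω ↔ (a ≤ x 0 + x 1 ∧ x 0 + x 1 ≤ b ∧ a' ≤ x 1 - x 0 ∧ x 1 - x 0 ≤ b'))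
  (hm : ∀ (μ : ℤ) (x : Site 2), μ ≤ m x ↔ (μ ≤ x 0 + x 1 - a ∧ μ ≤ b - (x 0 + x 1) ∧ μ ≤ x 1 - x 0 - a' ∧ μ ≤ b' - (x 1 - x 0)))
  (hobs : ∀ u g : Site 2, IsCorner u g → 2 ≤ m u → ‖cornerObs E δ u g‖ ≤ C₁ * ((m u : ℤ) : ℝ) ^ (-(1:ℝ) / 3))
  (hP : IsExactPair E δ Φ Ψ)

include hconv hEδ hgood hbox hm in
/-- **Every face at a site of lattice depth `≥ 2` is inner** (its corners lie in the `3 × 3` block, inside the box). -/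
theorem isInnerFace_of_margin {u g : Site 2} (hu : 2 ≤ m u) (hug : IsCorner u g) : E.IsInnerFace g := by
  refine isInnerFace_of_forall_corner_mem hconv hgood rfl hEδ fun w hw => (hbox w).2 ?_
  have h0 := abs_le.1 (abs_sub_le_one_of_isCorner hug hw 0)
  have h1 := abs_le.1 (abs_sub_le_one_of_isCorner hug hw 1)
  rw [hm] at hu
  omega

include hconv hEδ hgood hbox hm in
/-- A site of lattice depth `≥ 2` is off the discrete boundary (all four faces around it are inner). -/
theorem not_mem_zdBoundary_of_margin {u : Site 2} (hu : 2 ≤ m u) : u ∉ E.zdBoundary :=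
  not_mem_zdBoundary_of_forall_isInnerFace fun j => isInnerFace_of_margin hconv hEδ hgood hbox hm hu (isCorner_faceAt u j)

include hconv hEδ hgood hbox hm hobs hP in
/-- **The exact-pair increment at a deep corner**: `‖Φ u − Ψ g‖ ≤ C₁ · (m u)^{−1/3}` for every face `g` at a site
`u` of lattice depth `≥ 2` (class weight unimodular, observable bound `hobs`). -/
theorem norm_sub_face_le {u g : Site 2} (hu : 2 ≤ m u) (hug : IsCorner u g) :
    ‖Φ u - Ψ g‖ ≤ C₁ * ((m u : ℤ) : ℝ) ^ (-(1:ℝ) / 3) := by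
  have hnb := not_mem_zdBoundary_of_margin hconv hEδ hgood hbox hm hu
  rw [hP u g hug (isInnerFace_of_margin hconv hEδ hgood hbox hm hu hug) (fun h => hnb (E.zdArcA_subset_zdBoundary h))
    (fun h => hnb (E.zdArcB_subset_zdBoundary h)), norm_mul, norm_classWeight_of_isCorner hug, one_mul]
  exact hobs u g hug hu

include hconv hEδ hgood hbox hm hobs hP in
/-- **One step of the chain**: two lattice neighbours of depth `≥ 2` share the face `faceAt u k`, so their site
potentials differ by at most the two corner bounds. -/
theorem norm_step_le {u : Site 2} (k : Fin 4) (hu : 2 ≤ m u)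
    (hu' : 2 ≤ m (u + cornerUnit k)) :
    ‖Φ u - Φ (u + cornerUnit k)‖ ≤ C₁ * ((m u : ℤ) : ℝ) ^ (-(1:ℝ) / 3) +
      C₁ * ((m (u + cornerUnit k) : ℤ) : ℝ) ^ (-(1:ℝ) / 3) := by
  have h1 := norm_sub_face_le hconv hEδ hgood hbox hm hobs hP hu (isCorner_faceAt u k)
  have h2 := norm_sub_face_le hconv hEδ hgood hbox hm hobs hP hu' ((isCorner_add_faceAt_iff u k k).2 (Or.inl rfl))
  calc ‖Φ u - Φ (u + cornerUnit k)‖ = ‖(Φ u - Ψ (faceAt u k)) - (Φ (u + cornerUnit k) - Ψ (faceAt u k))‖ := by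
        congr 1; ring
    _ ≤ _ := norm_sub_le _ _
    _ ≤ _ := add_le_add h1 h2

/-! ## The legs -/

include hconv hEδ hgood hbox hm hobs hP in
/-- **A straight leg of the chain**: along `u + j • cornerUnit k`, `j ≤ n`, through sites of depth `≥ 2`, the consecutive
differences of `Φ` are bounded by `β j + β (j+1)`, `β j = C₁ · (m (u + j • cornerUnit k))^{−1/3}`. -/
theorem leg_steps (u : Site 2) (k : Fin 4) (n : ℕ) (hmar : ∀ j : ℕ, j ≤ n → 2 ≤ m (u + (j : ℤ) • cornerUnit k)) :
    ∀ j < n, ‖Φ (u + (j : ℤ) • cornerUnit k) - Φ (u + ((j + 1 : ℕ) : ℤ) • cornerUnit k)‖ ≤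
      C₁ * ((m (u + (j : ℤ) • cornerUnit k) : ℤ) : ℝ) ^ (-(1:ℝ) / 3) +
        C₁ * ((m (u + ((j + 1 : ℕ) : ℤ) • cornerUnit k) : ℤ) : ℝ) ^ (-(1:ℝ) / 3) := by
  intro j hj
  have e := walk_succ u (cornerUnit k) j
  rw [e]
  refine norm_step_le hconv hEδ hgood hbox hm hobs hP k (hmar j hj.le) ?_
  rw [← e]; exact hmar (j + 1) hj

omit hP in
include hobs in
/-- The depth bound as a function of a lower bound on the depth: `m x ≥ μ > 0` gives `β ≤ C₁ μ^{−1/3}`. -/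
theorem beta_le_of_le_margin (hC₁ : 0 ≤ C₁) {x : Site 2} {μ : ℝ} (hμ : 0 < μ) (hle : μ ≤ ((m x : ℤ) : ℝ)) :
    C₁ * ((m x : ℤ) : ℝ) ^ (-(1:ℝ) / 3) ≤ C₁ * μ ^ (-(1:ℝ) / 3) := by
  have _ := hobs
  exact mul_le_mul_of_nonneg_left (Real.rpow_le_rpow_of_nonpos hμ hle (by norm_num)) hC₁

include hconv hEδ hgood hbox hm hobs hP in
/-- **Inward leg**: if the `j`-th site of the straight leg has depth `≥ j + 2` (`j ≤ n`), the leg costs `≤ 3 C₁ n^{2/3}`. -/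
theorem norm_inward_le (hC₁ : 0 ≤ C₁) (u : Site 2) (k : Fin 4) (n : ℕ)
    (hmar : ∀ j : ℕ, j ≤ n → (j : ℤ) + 2 ≤ m (u + (j : ℤ) • cornerUnit k)) :
    ‖Φ u - Φ (u + (n : ℤ) • cornerUnit k)‖ ≤ 3 * C₁ * (n : ℝ) ^ ((2:ℝ) / 3) := by
  have hsteps := leg_steps hconv hEδ hgood hbox hm hobs hP u k n fun j hj => by have := hmar j hj; omega
  have key := (diamondCollar_legSum (fun j => Φ (u + (j : ℤ) • cornerUnit k))
    (fun j => C₁ * ((m (u + (j : ℤ) • cornerUnit k) : ℤ) : ℝ) ^ (-(1:ℝ) / 3)) C₁ n hC₁ hsteps).1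
  simp only [Nat.cast_zero, zero_smul, add_zero] at key
  refine key fun j hj => beta_le_of_le_margin hobs hC₁ (by positivity) ?_
  have := hmar j hj
  have : (((j : ℤ) + 1 : ℤ) : ℝ) ≤ ((m (u + (j : ℤ) • cornerUnit k) : ℤ) : ℝ) := by
    exact_mod_cast (by omega : (j : ℤ) + 1 ≤ m (u + (j : ℤ) • cornerUnit k))
  push_cast at this
  exact this

include hconv hEδ hgood hbox hm hobs hP in
/-- **Across leg**: if every site of a straight leg of `n ≤ N + 1` steps has depth `≥ N + 2`, the leg costs
`≤ 2 C₁ (N+1)^{2/3}`. -/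
theorem norm_across_le (hC₁ : 0 ≤ C₁) (u : Site 2) (k : Fin 4) {n N : ℕ} (hn : n ≤ N + 1)
    (hmar : ∀ j : ℕ, j ≤ n → (N : ℤ) + 2 ≤ m (u + (j : ℤ) • cornerUnit k)) :
    ‖Φ u - Φ (u + (n : ℤ) • cornerUnit k)‖ ≤ 2 * C₁ * ((N : ℝ) + 1) ^ ((2:ℝ) / 3) := by
  have hsteps := leg_steps hconv hEδ hgood hbox hm hobs hP u k n fun j hj => by have := hmar j hj; omega
  have key := (diamondCollar_legSum (fun j => Φ (u + (j : ℤ) • cornerUnit k))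
    (fun j => C₁ * ((m (u + (j : ℤ) • cornerUnit k) : ℤ) : ℝ) ^ (-(1:ℝ) / 3)) C₁ n hC₁ hsteps).2 N hn
  simp only [Nat.cast_zero, zero_smul, add_zero] at key
  refine key fun j hj => beta_le_of_le_margin hobs hC₁ (by positivity) ?_
  have : (((N : ℤ) + 1 : ℤ) : ℝ) ≤ ((m (u + (j : ℤ) • cornerUnit k) : ℤ) : ℝ) := by
    exact_mod_cast (by have := hmar j hj; omega : (N : ℤ) + 1 ≤ m (u + (j : ℤ) • cornerUnit k))
  push_cast at this
  exact this

end Step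

/-! ## The geometry of the chain: depths along the four legs -/

/-- **Depth along the inward legs.** There is one lattice direction `k` (INWARD at `v`: towards the two centre lines of
the box — `cornerUnit 1 = e₁ : (+,+)`, `0 = e₀ : (+,−)`, `2 = −e₀ : (−,+)`, `3 = −e₁ : (−,−)` on `(x₀ + x₁, x₁ − x₀)`) such
that for every interior site `u` within `N` of `v` in each coordinate, in a box of side lengths `≥ 16N + 4`, the `j`-th
site of the straight walk from `u` in direction `k` has depth `≥ j + 2` for all `j ≤ 3N`. -/
theorem margin_inward {a b a' b' : ℤ} {m : Site 2 → ℤ}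
    (hm : ∀ (μ : ℤ) (x : Site 2), μ ≤ m x ↔ (μ ≤ x 0 + x 1 - a ∧ μ ≤ b - (x 0 + x 1) ∧ μ ≤ x 1 - x 0 - a' ∧ μ ≤ b' - (x 1 - x 0)))
    {N : ℕ} (hba : 16 * (N : ℤ) + 4 ≤ b - a) (hba' : 16 * (N : ℤ) + 4 ≤ b' - a') (v : Site 2) :
    ∃ k : Fin 4, ∀ u : Site 2, 2 ≤ m u → |u 0 - v 0| ≤ N → |u 1 - v 1| ≤ N →
      ∀ j : ℕ, j ≤ 3 * N → (j : ℤ) + 2 ≤ m (u + (j : ℤ) • cornerUnit k) := by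
  have main : ∀ k : Fin 4, ((k = 1 ∧ 2 * (v 0 + v 1) ≤ a + b ∧ 2 * (v 1 - v 0) ≤ a' + b') ∨
      (k = 0 ∧ 2 * (v 0 + v 1) ≤ a + b ∧ ¬ 2 * (v 1 - v 0) ≤ a' + b') ∨
      (k = 2 ∧ ¬ 2 * (v 0 + v 1) ≤ a + b ∧ 2 * (v 1 - v 0) ≤ a' + b') ∨
      (k = 3 ∧ ¬ 2 * (v 0 + v 1) ≤ a + b ∧ ¬ 2 * (v 1 - v 0) ≤ a' + b')) →
      ∀ u : Site 2, 2 ≤ m u → |u 0 - v 0| ≤ N → |u 1 - v 1| ≤ N →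
        ∀ j : ℕ, j ≤ 3 * N → (j : ℤ) + 2 ≤ m (u + (j : ℤ) • cornerUnit k) := by
    intro k hk u hu h0 h1 j hj
    have hj' : (j : ℤ) ≤ 3 * N := by exact_mod_cast hj
    rw [abs_le] at h0 h1
    rw [hm] at hu ⊢
    obtain ⟨⟨c0, c1⟩, c2, c3⟩ := walk_apply u (j : ℤ)
    rcases hk with ⟨rfl, hs, hd⟩ | ⟨rfl, hs, hd⟩ | ⟨rfl, hs, hd⟩ | ⟨rfl, hs, hd⟩
    · rw [c1.1, c1.2]; omega
    · rw [c0.1, c0.2]; omega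
    · rw [c2.1, c2.2]; omega
    · rw [c3.1, c3.2]; omega
  by_cases hs : 2 * (v 0 + v 1) ≤ a + b <;> by_cases hd : 2 * (v 1 - v 0) ≤ a' + b'
  · exact ⟨1, main 1 (Or.inl ⟨rfl, hs, hd⟩)⟩
  · exact ⟨0, main 0 (Or.inr (Or.inl ⟨rfl, hs, hd⟩))⟩
  · exact ⟨2, main 2 (Or.inr (Or.inr (Or.inl ⟨rfl, hs, hd⟩)))⟩
  · exact ⟨3, main 3 (Or.inr (Or.inr (Or.inr ⟨rfl, hs, hd⟩)))⟩

/-- **Depth along the across legs.** Every site within `N` (first coordinate) and `N` (second coordinate) of a site `P`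
of depth `≥ 3N + 2` has depth `≥ N + 2`. -/
theorem margin_near {a b a' b' : ℤ} {m : Site 2 → ℤ}
    (hm : ∀ (μ : ℤ) (x : Site 2), μ ≤ m x ↔ (μ ≤ x 0 + x 1 - a ∧ μ ≤ b - (x 0 + x 1) ∧ μ ≤ x 1 - x 0 - a' ∧ μ ≤ b' - (x 1 - x 0)))
    {N : ℕ} {P x : Site 2} (hP : 3 * (N : ℤ) + 2 ≤ m P)
    (h0 : |x 0 - P 0| ≤ N) (h1 : |x 1 - P 1| ≤ N) : (N : ℤ) + 2 ≤ m x := by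
  rw [abs_le] at h0 h1
  rw [hm] at hP ⊢
  omega

end Collar

open Collar

/-- **The cell chain through the bulk** (registered helper of `collar_of_uniformInnerEnvelope`). For a datum `E` on a convex
domain read at mesh `δ`, every lattice point of the domain in `Ω_δ`, lattice points = the box `[a, b] × [a', b']` in the
coordinates `x₀ + x₁`, `x₁ − x₀`, corner observables at sites of lattice depth `m ≥ 2` bounded by `C₁ m^{−1/3}`: for every
exact pair `(Φ, Ψ)` and interior sites `v`, `v'` (depth `≥ 2`) within `N` of each other in each coordinate, in a box of
side lengths `≥ 16N + 4`, `‖Φ v − Φ v'‖ ≤ 10 C₁ (3N + 1)^{2/3}` — by the chain INWARD from `v` (`3N` diagonal steps, the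
`j`-th at depth `≥ j + 2`), ACROSS (`≤ 2N` axis steps at depth `≥ N + 2`) and OUTWARD to `v'`. -/
theorem diamondCollar_walk : ∀ (E : DiscreteDobrushin) (δ : ℝ) (a b a' b' : ℤ) (m : Site 2 → ℤ) (C₁ : ℝ) (Φ Ψ : Site 2 → ℂ) (N : ℕ) (v v' : Site 2), Convex ℝ E.Ω → E.δ = δ → (∀ x : Site 2, meshPoint δ x ∈ E.Ω → x ∈ meshDomain E.Ω δ) → (∀ x : Site 2, meshPoint δ x ∈ E.Ω ↔ (a ≤ x 0 + x 1 ∧ x 0 + x 1 ≤ b ∧ a' ≤ x 1 - x 0 ∧ x 1 - x 0 ≤ b')) → (∀ (μ : ℤ) (x : Site 2), μ ≤ m x ↔ (μ ≤ x 0 + x 1 - a ∧ μ ≤ b - (x 0 + x 1) ∧ μ ≤ x 1 - x 0 - a' ∧ μ ≤ b' - (x 1 - x 0))) → 0 ≤ C₁ → (∀ u g : Site 2, IsCorner u g → 2 ≤ m u → ‖cornerObs E δ u g‖ ≤ C₁ * ((m u : ℤ) : ℝ) ^ (-(1:ℝ) / 3)) → IsExactPair E δ Φ Ψ → 2 ≤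 m v → 2 ≤ m v' → |v' 0 - v 0| ≤ N → |v' 1 - v 1| ≤ N → 16 * (N : ℤ) + 4 ≤ b - a → 16 * (N : ℤ) + 4 ≤ b' - a' → ‖Φ v - Φ v'‖ ≤ 10 * C₁ * (3 * (N : ℝ) + 1) ^ ((2:ℝ) / 3) := by
  intro E δ a b a' b' m C₁ Φ Ψ N v v' hconv hEδ hgood hbox hm hC₁ hobs hP hv hv' h0 h1 hba hba'
  have h0' := abs_le.1 h0
  have h1' := abs_le.1 h1
  -- the two inward legs, in the inward direction `k` at `v`
  obtain ⟨k, hk⟩ := margin_inward hm hba hba' v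
  have marv := hk v hv (by simp) (by simp)
  have marv' := hk v' hv' h0 h1
  have legv := norm_inward_le hconv hEδ hgood hbox hm hobs hP hC₁ v k (3 * N) marv
  have legv' := norm_inward_le hconv hEδ hgood hbox hm hobs hP hC₁ v' k (3 * N) marv'
  have hPmar : 3 * (N : ℤ) + 2 ≤ m (v + ((3 * N : ℕ) : ℤ) • cornerUnit k) := by
    have := marv (3 * N) le_rfl; push_cast at this ⊢; linarith
  set P := v + ((3 * N : ℕ) : ℤ) • cornerUnit k with hPdef
  set P' := v' + ((3 * N : ℕ) : ℤ) • cornerUnit k with hP'def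
  -- coordinates of `P`, `P'`
  have hPP' : P' 0 - P 0 = v' 0 - v 0 ∧ P' 1 - P 1 = v' 1 - v 1 := by
    simp only [hPdef, hP'def, Pi.add_apply, Pi.smul_apply, smul_eq_mul]; omega
  -- across, first coordinate: direction `e₀` or `−e₀`
  obtain ⟨kx, mx, hmx, hQ⟩ : ∃ (kx : Fin 4) (mx : ℕ), mx ≤ N ∧
      ∀ j : ℤ, (P + j • cornerUnit kx) 1 = P 1 ∧ ((P + j • cornerUnit kx) 0 = P 0 + j ∨ (P + j • cornerUnit kx) 0 = P 0 - j) ∧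
        (P + (mx : ℤ) • cornerUnit kx) 0 = P 0 + (v' 0 - v 0) := by
    rcases le_or_gt (v 0) (v' 0) with hle | hlt
    · refine ⟨0, (v' 0 - v 0).toNat, ?_, fun j => ?_⟩
      · have : ((v' 0 - v 0).toNat : ℤ) ≤ N := by rw [Int.toNat_of_nonneg (by omega)]; omega
        exact_mod_cast this
      · obtain ⟨⟨c0, -⟩, -, -⟩ := walk_apply P j
        obtain ⟨⟨d0, -⟩, -, -⟩ := walk_apply P ((v' 0 - v 0).toNat : ℤ)
        refine ⟨c0.2, Or.inl c0.1, ?_⟩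
        rw [d0.1, Int.toNat_of_nonneg (by omega)]
    · refine ⟨2, (v 0 - v' 0).toNat, ?_, fun j => ?_⟩
      · have : ((v 0 - v' 0).toNat : ℤ) ≤ N := by rw [Int.toNat_of_nonneg (by omega)]; omega
        exact_mod_cast this
      · obtain ⟨-, c2, -⟩ := walk_apply P j
        obtain ⟨-, d2, -⟩ := walk_apply P ((v 0 - v' 0).toNat : ℤ)
        refine ⟨c2.2, Or.inr c2.1, ?_⟩
        rw [d2.1, Int.toNat_of_nonneg (by omega)]; ring
  set Q := P + (mx : ℤ) • cornerUnit kx with hQdef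
  have hQ0 : Q 0 = P 0 + (v' 0 - v 0) := (hQ mx).2.2
  have hQ1 : Q 1 = P 1 := (hQ mx).1
  have legx : ‖Φ P - Φ Q‖ ≤ 2 * C₁ * ((N : ℝ) + 1) ^ ((2:ℝ) / 3) := by
    refine norm_across_le hconv hEδ hgood hbox hm hobs hP hC₁ P kx (by omega) fun j hj => ?_
    obtain ⟨e1, e0, -⟩ := hQ j
    refine margin_near hm hPmar ?_ ?_
    · rw [abs_le]; have : (j : ℤ) ≤ N := by exact_mod_cast hj.trans hmx
      rcases e0 with e0 | e0 <;> rw [e0] <;> omega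
    · rw [e1]; simp
  -- across, second coordinate: direction `e₁` or `−e₁`
  obtain ⟨ky, my, hmy, hR⟩ : ∃ (ky : Fin 4) (my : ℕ), my ≤ N ∧
      ∀ j : ℤ, (Q + j • cornerUnit ky) 0 = Q 0 ∧ ((Q + j • cornerUnit ky) 1 = Q 1 + j ∨ (Q + j • cornerUnit ky) 1 = Q 1 - j) ∧
        (Q + (my : ℤ) • cornerUnit ky) 1 = Q 1 + (v' 1 - v 1) := by
    rcases le_or_gt (v 1) (v' 1) with hle | hlt
    · refine ⟨1, (v' 1 - v 1).toNat, ?_, fun j => ?_⟩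
      · have : ((v' 1 - v 1).toNat : ℤ) ≤ N := by rw [Int.toNat_of_nonneg (by omega)]; omega
        exact_mod_cast this
      · obtain ⟨⟨-, c1⟩, -, -⟩ := walk_apply Q j
        obtain ⟨⟨-, d1⟩, -, -⟩ := walk_apply Q ((v' 1 - v 1).toNat : ℤ)
        refine ⟨c1.1, Or.inl c1.2, ?_⟩
        rw [d1.2, Int.toNat_of_nonneg (by omega)]
    · refine ⟨3, (v 1 - v' 1).toNat, ?_, fun j => ?_⟩
      · have : ((v 1 - v' 1).toNat : ℤ) ≤ N := by rw [Int.toNat_of_nonneg (by omega)]; omega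
        exact_mod_cast this
      · obtain ⟨-, -, c3⟩ := walk_apply Q j
        obtain ⟨-, -, d3⟩ := walk_apply Q ((v 1 - v' 1).toNat : ℤ)
        refine ⟨c3.1, Or.inr c3.2, ?_⟩
        rw [d3.2, Int.toNat_of_nonneg (by omega)]; ring
  have legy : ‖Φ Q - Φ (Q + (my : ℤ) • cornerUnit ky)‖ ≤ 2 * C₁ * ((N : ℝ) + 1) ^ ((2:ℝ) / 3) := by
    refine norm_across_le hconv hEδ hgood hbox hm hobs hP hC₁ Q ky (by omega) fun j hj => ?_
    obtain ⟨e0, e1, -⟩ := hR j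
    refine margin_near hm hPmar ?_ ?_
    · rw [e0, hQ0, abs_le]; omega
    · rw [abs_le]; have : (j : ℤ) ≤ N := by exact_mod_cast hj.trans hmy
      rcases e1 with e1 | e1 <;> rw [e1, hQ1] <;> omega
  -- the end of the second across leg is `P'`
  have hend : Q + (my : ℤ) • cornerUnit ky = P' := by
    obtain ⟨e0, -, e1⟩ := hR my
    ext i; fin_cases i
    · show (Q + (my : ℤ) • cornerUnit ky) 0 = P' 0
      rw [e0, hQ0]; omega
    · show (Q + (my : ℤ) • cornerUnit ky) 1 = P' 1
      rw [e1, hQ1]; omega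
  rw [hend] at legy
  -- assemble
  have hN0 : (0 : ℝ) ≤ N := Nat.cast_nonneg N
  have hmono1 : (((3 * N : ℕ)) : ℝ) ^ ((2:ℝ) / 3) ≤ (3 * (N : ℝ) + 1) ^ ((2:ℝ) / 3) :=
    Real.rpow_le_rpow (by positivity) (by push_cast; linarith) (by norm_num)
  have hmono2 : ((N : ℝ) + 1) ^ ((2:ℝ) / 3) ≤ (3 * (N : ℝ) + 1) ^ ((2:ℝ) / 3) :=
    Real.rpow_le_rpow (by positivity) (by linarith) (by norm_num)
  have i1 := mul_le_mul_of_nonneg_left hmono1 (by positivity : (0:ℝ) ≤ 3 * C₁)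
  have i2 := mul_le_mul_of_nonneg_left hmono2 (by positivity : (0:ℝ) ≤ 2 * C₁)
  have t1 := norm_sub_le ((Φ v - Φ P) + (Φ P - Φ Q) + (Φ Q - Φ P')) (Φ v' - Φ P')
  have t2 := norm_add_le ((Φ v - Φ P) + (Φ P - Φ Q)) (Φ Q - Φ P')
  have t3 := norm_add_le (Φ v - Φ P) (Φ P - Φ Q)
  have e : Φ v - Φ v' = (Φ v - Φ P) + (Φ P - Φ Q) + (Φ Q - Φ P') - (Φ v' - Φ P') := by ring
  rw [e]
  linarith

end Summit.CriticalPhenomena.CardyFormulaZ2.Cruxes.ParafermionToSLESixFamilies.PotentialDarbouxPicardDiamond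

end
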